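import Summits.ResolutionOfSingularities.ResolutionOfSingularities.Theorems.ConeCutLayersPoint
import Summits.ResolutionOfSingularities.ResolutionOfSingularities.Theorems.ConeCutClasses
import Summits.ResolutionOfSingularities.ResolutionOfSingularities.Theorems.ExitLawWalks
import Summits.ResolutionOfSingularities.ResolutionOfSingularities.Theorems.NoJump
import Summits.ResolutionOfSingularities.ResolutionOfSingularities.Theorems.JumpCutClasses
import Summits.ResolutionOfSingularities.ResolutionOfSingularities.Theorems.MaxContactCutItineraryCut
import Summits.ResolutionOfSingularities.ResolutionOfSingularities.Theorems.MaxContactCutExponentLadder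
import Summits.ResolutionOfSingularities.ResolutionOfSingularities.Theorems.MaxContactCutFloorCut
import HarnessLib

/-!
# ConeCutWalks — tree file 4/11: §B along forced walks (three variables): `resForm`, `bUnit`, `binExp`, the CONE
LAW at every high
plateau step and the POWER LAW `resForm_eq_pow_of_repeat`.  PROVED.  (Uses the tree's `NoJump.order_lt_two_mul` /
`r_succ_chart`.)

Content VERBATIM from the decomp-res lens-3 g15 file `HOME/decomp-res-lens-3/g15/parts/ConeCut-rev5-f76e5309.lean`
(sha256 f76e53096babc227…; CRITIC-LEDGER
rows 102/105/110/123 CLEARED, landing orders 15:53:15Z / 17:40:15Z).  HOME = run/shared/lean/pub/decomp-res.  Host: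
route `MaxContactCut`, aside
31770 `DefectWalksDeep` (and 31870) through the tree's lens-3 g14 `Theorems/FloorCut{Classes,Floor}` + `MaxContactCutFloorCut`.

[WRITER NOTE (decomp-res writer g6): per the lens's own landing instruction its §0 (l.130–876 = g14 `FloorCut`
VERBATIM) is DELETED and the
tree's `…Theorems.FloorCut` opened instead; §C⁵ `section AxisLaw` (l.2949–3086) is the tree's
`Theorems/ConeCutAxisLaw` (landed earlier,
opened here); the restated ProximityCut letters `LeavesNewest` / `StaysOnNewest` / `leavesNewest_iff_not_stays` /
`NoFreePointTailsDeep`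
(byte-identical to `Theorems/ProximityCutClasses`) are deleted and opened from the tree; the three class definitions
`IsTameFrom`,
`NoMixedTailsDeep`, `NoTameMixedTailsDeep` live in the cone-free `Theorems/ConeCutClasses` (so the route can import
the co-owned MIXED
aside).  Split: ConeCutClasses · ConeCutLayers / ConeCutLayersPoint (§A state level) · ConeCutWalks (§B) ·
ConeCutLawB (§C) · ConeCutRepeats
(§B⁺, §B⁺⁺⁺ part 1) · ConeCutLawE (§B⁺⁺⁺ part 2, LAW E) · ConeCutZigzag (§B⁺⁺
Fibonacci/zigzag, LAW C) · ConeCutLaws (all-repeat rigidity,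
LAW I, §D booking) · MaxContactCutConeCut / MaxContactCutConeCutCells (§D wiring to 31770/31870 BY NAME, Theses
cone).  ONE namespace
`…Theorems.ConeCut` as in the lens; global `set_option` lines dropped; nothing else changed.  `fin3_cases` is the tree's `ExitLaw.fin3_cases`
(ExitLawWalks), copy deleted and opened.]
(Sources: Hauser2010 §§D,F,G; HauserPerlega2019; Moh1987; CossartPiltant2019; CossartJannsenSaito2020 Thm. 2.14,
§§5,9; BenitoVillamayor2013 §7; CasasAlvero2000 Ch. 3; BierstoneGrigorievMilmanWlodarczyk2011 Def. 3.1.3.)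
-/

noncomputable section

open MvPolynomial Finset
open Literature.AlgebraicGeometry.Resolution
open Literature.AlgebraicGeometry.Resolution.Hauser2010
open Literature.AlgebraicGeometry.Resolution.PointBlowup
open Summit.ResolutionOfSingularities.ResolutionOfSingularities.Theorems.TightDefectClasses
open Summit.ResolutionOfSingularities.ResolutionOfSingularities.Theorems.TightDefectStrongWalks
open Summit.ResolutionOfSingularities.ResolutionOfSingularities.Theorems.ItineraryCutClasses
open Summit.ResolutionOfSingularities.ResolutionOfSingularities.Theorems.BoundaryLedger
open Literature.AlgebraicGeometry.Resolution.WeightedBlowup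
open Literature.Barriers.ResolutionOfSingularities
open Summit.ResolutionOfSingularities.ResolutionOfSingularities.Theorems.FloorCut
open Summit.ResolutionOfSingularities.ResolutionOfSingularities.Theorems.ConeCutAxisLaw
open Summit.ResolutionOfSingularities.ResolutionOfSingularities.Theorems.ProximityCut (NoOriginTails LeavesNewest StaysOnNewest)
open Summit.ResolutionOfSingularities.ResolutionOfSingularities.Theorems.ProximityCut (leavesNewest_iff_not_stays NoFreePointTailsDeep)
open Summit.ResolutionOfSingularities.ResolutionOfSingularities.Theorems.ExitLaw (fin3_cases)

namespace Summit.ResolutionOfSingularities.ResolutionOfSingularities.Theorems.ConeCut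

/-! ## §B  Along forced walks (three variables): the cone law at every high plateau step -/

section Walks

variable {K : Type} [Field K] [DecidableEq K] {q : ℕ} {s₀ : State (Fin 3) K}

/-- The RESIDUAL FORM of move `t` (at order `o`): the translated residual layer `N_t = M_t(u + b_t)`.
DEFINITION (support). -/
def resForm (W : ForcedWalk q s₀) (t : ℕ) (o : ℕ) : MvPolynomial (Fin 3) K :=
  translate (W.b t) (resLayer (W.j t) (W.st t) o)

/-- The boundary unit of move `t`: `U_t(0) = ∏_{b_t l ≠ 0} (b_t l)^{r_t l} ≠ 0`. DEFINITION (support). -/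
def bUnit (W : ForcedWalk q s₀) (t : ℕ) : K :=
  coeff 0 (translate (W.b t) (monomial ((W.st t).r.filter (fun l => W.b t l ≠ 0)) (1 : K)))

/-- `bUnit_ne_zero`: Auxiliary step of this node's calculus, VERBATIM from the lens file (see the module docstring); the statement is its type. [folklore] -/
theorem bUnit_ne_zero (W : ForcedWalk q s₀) (t : ℕ) : bUnit W t ≠ 0 :=
  coeff_zero_translate_boundary_ne_zero (W.b t) (W.st t).r

/-- The plateau ledger in the cone law's shape: `o' = (o − |r_t|) + |kept_t| + (o − q)`. [folklore] -/
theorem plateau_ledger (hroot : IsRoot q s₀) (W : ForcedWalk q s₀) (t : ℕ) {o o' : ℕ}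
    (ho : ordZero (W.st t).F = o) (ho' : ordZero (W.st (t + 1)).F = o')
    (hplat : (W.st (t + 1)).shade = (W.st t).shade) :
    o' = (o - (W.st t).r.degree) + (kept W t).degree + (o - q) := by
  obtain ⟨n, hn, hon⟩ := order_eq_shade_add_degree hroot W t ho
  obtain ⟨n', hn', hon'⟩ := order_eq_shade_add_degree hroot W (t + 1) ho'
  have hss : n' = n := by
    have h := hplat
    rw [hn, hn'] at h
    exact_mod_cast h
  have hdeg := degree_r_succ W t ho
  omega

/-- **THE CONE LAW ALONG A WALK (PROVED).**  At every move `t → t+1` of a forced walk from a root that does not move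
the shade and starts from order `o_t > q`, the residual form `N_t` is a NON-ZERO FORM OF DEGREE THE SHADE `s_t`:
the residual tangent cone `in(F_t)/u^{r_t}` is a cone over the centre direction, of multiplicity exactly `s_t` there.
[new] [folklore] -/
theorem cone_of_plateau (hroot : IsRoot q s₀) (W : ForcedWalk q s₀) (t : ℕ) {o : ℕ} (ho : ordZero (W.st t).F = o)
    (hqo : q < o) (hplat : (W.st (t + 1)).shade = (W.st t).shade) {n : ℕ} (hn : (W.st t).shade = (n : ℕ∞)) :
    (resForm W t o).IsHomogeneous n ∧ resForm W t o ≠ 0 := by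
  classical
  obtain ⟨o₁, ho₁, -, ho2⟩ := NoJump.order_lt_two_mul hroot W t
  have hoo : o₁ = o := by have h := ho₁.symm.trans ho; exact_mod_cast h
  rw [hoo] at ho2
  obtain ⟨o', ho', -, ho'2⟩ := NoJump.order_lt_two_mul hroot W (t + 1)
  obtain ⟨n₁, hn₁, hon⟩ := order_eq_shade_add_degree hroot W t ho
  have hnn : n₁ = n := by have h := hn₁.symm.trans hn; exact_mod_cast h
  have hled := plateau_ledger hroot W t ho ho' hplat
  have hst : ordZero (step q (W.j t) (W.b t) (W.st t)).F = o' := by rw [← W.st_succ]; exact ho'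
  have h := cone_law (by omega) (W.j t) (W.b t) (W.onExc t) (W.st t) (walk_r hroot W t) (W.equimult t) ho hqo ho2
    hst ho'2 (by unfold kept at hled; exact hled)
  rw [show o - (W.st t).r.degree = n by omega] at h
  exact h

/-- The residual form never involves the chart variable `u_{j_t}`. [folklore] -/
theorem coeff_resForm_eq_zero (W : ForcedWalk q s₀) (t o : ℕ) {E : Fin 3 →₀ ℕ} (hE : E (W.j t) ≠ 0) :
    coeff E (resForm W t o) = 0 :=
  coeff_translate_resLayer_eq_zero (W.j t) (W.b t) (W.st t) o hE

/-- **THE RESTRICTION IDENTITY ALONG A WALK (PROVED).**  On a plateau step from order `o_t > q`: for every exponent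
`m` off the chart variable with `|m| = s_t`, `coeff_{r_{t+1} + m} F_{t+1} = U_t(0) · coeff_m N_t` — the `u_{j_t}`-free
face of the next residual cone IS the residual form. [new] [folklore] -/
theorem restriction_of_plateau (hroot : IsRoot q s₀) (W : ForcedWalk q s₀) (t : ℕ) {o : ℕ}
    (ho : ordZero (W.st t).F = o) (hqo : q < o) (hplat : (W.st (t + 1)).shade = (W.st t).shade) {n : ℕ}
    (hn : (W.st t).shade = (n : ℕ∞)) (m : Fin 3 →₀ ℕ) (hmj : m (W.j t) = 0) (hm : m.degree = n) :
    coeff ((W.st (t + 1)).r + m) (W.st (t + 1)).F = bUnit W t * coeff m (resForm W t o) := by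
  classical
  obtain ⟨o₁, ho₁, -, ho2⟩ := NoJump.order_lt_two_mul hroot W t
  have hoo : o₁ = o := by have h := ho₁.symm.trans ho; exact_mod_cast h
  rw [hoo] at ho2
  obtain ⟨o', ho', -, ho'2⟩ := NoJump.order_lt_two_mul hroot W (t + 1)
  obtain ⟨n₁, hn₁, hon⟩ := order_eq_shade_add_degree hroot W t ho
  have hnn : n₁ = n := by have h := hn₁.symm.trans hn; exact_mod_cast h
  have hled := plateau_ledger hroot W t ho ho' hplat
  have hst : ordZero (step q (W.j t) (W.b t) (W.st t)).F = o' := by rw [← W.st_succ]; exact ho'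
  have h := restriction_identity (by omega) (W.j t) (W.b t) (W.onExc t) (W.st t) (walk_r hroot W t) (W.equimult t)
    ho hqo ho2 hst ho'2 (by unfold kept at hled; exact hled) m hmj (by omega)
  rw [← W.st_succ] at h
  have hr : (W.st (t + 1)).r + m = ((W.st t).r.filter (fun i => W.b t i = 0)).erase (W.j t) + m +
      Finsupp.single (W.j t) (o - q) := by
    rw [r_succ_eq W t ho]
    unfold kept
    rw [add_right_comm]
  rw [hr]
  exact h

/-! ### The power law at proximity repeats -/

omit [DecidableEq K] in
/-- **Pure slice of a translated binary form (PROVED).**  If `P` is a form of degree `n` in `u_j, u_k` (no `u_i`) and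
`c_j = 0`, then the pure-`u_k` coefficients of `P(u + c)` come from the single monomial `u_k^n`:
`coeff_{a e_k} P(u+c) = coeff_{n e_k} P · C(n,a) c_k^{n−a}`. [folklore] -/
theorem coeff_single_translate {i j k : Fin 3} (hij : i ≠ j) (hki : k ≠ i) (hkj : k ≠ j) (c : Fin 3 → K)
    (hcj : c j = 0) (P : MvPolynomial (Fin 3) K) {n : ℕ} (hP : P.IsHomogeneous n)
    (hPi : ∀ D : Fin 3 →₀ ℕ, D i ≠ 0 → coeff D P = 0) (a : ℕ) :
    coeff (Finsupp.single k a) (translate c P) =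
      coeff (Finsupp.single k n) P * (((n.choose a : ℕ) : K) * c k ^ (n - a)) := by
  classical
  conv_lhs => rw [P.as_sum, translate_finset_sum, coeff_sum]
  rw [Finset.sum_eq_single (Finsupp.single k n)]
  · rw [coeff_translate_monomial, Finset.prod_eq_single k]
    · rw [Finsupp.single_eq_same, Finsupp.single_eq_same]
    · intro l _ hl
      rw [Finsupp.single_eq_of_ne hl, Finsupp.single_eq_of_ne hl]
      simp
    · intro h; exact absurd (Finset.mem_univ k) h
  · intro D hD hne
    have hc : coeff D P ≠ 0 := MvPolynomial.mem_support_iff.mp hD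
    have hDi : D i = 0 := by
      by_contra h
      exact hc (hPi D h)
    have hdeg : D.degree = n := by
      by_contra h
      exact hc (hP.coeff_eq_zero h)
    have hDj : D j ≠ 0 := by
      intro hDj0
      apply hne
      ext l
      rcases fin3_cases hij hki hkj l with h | h | h
      · rw [h, hDi, Finsupp.single_eq_of_ne hki.symm]
      · rw [h, hDj0, Finsupp.single_eq_of_ne hkj.symm]
      · rw [h, Finsupp.single_eq_same]
        have := degree_eq_add_sum_erase k D
        have h0 : ∑ l ∈ univ.erase k, D l = 0 := by
          refine Finset.sum_eq_zero fun l hl => ?_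
          rcases fin3_cases hij hki hkj l with h' | h' | h'
          · rw [h', hDi]
          · rw [h', hDj0]
          · exact absurd h' (Finset.ne_of_mem_erase hl)
        omega
    exact coeff_translate_monomial_eq_zero_of_apply_eq_zero c D _ _ hcj (by
      rw [Finsupp.single_eq_of_ne hkj.symm]; exact Nat.pos_of_ne_zero hDj)
  · intro h
    rw [MvPolynomial.notMem_support_iff.mp h, map_zero]
    unfold PointBlowup.translate
    rw [map_zero, coeff_zero]

/-- The exponent `u_i^{n−a} u_k^a`. DEFINITION (support). -/
def binExp (i k : Fin 3) (n a : ℕ) : Fin 3 →₀ ℕ := Finsupp.single i (n - a) + Finsupp.single k a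

/-- `binExp_apply_of_ne`: Auxiliary step of this node's calculus, VERBATIM from the lens file (see the module docstring); the statement is its type. [folklore] -/
theorem binExp_apply_of_ne {i k l : Fin 3} (hli : l ≠ i) (hlk : l ≠ k) (n a : ℕ) : binExp i k n a l = 0 := by
  unfold binExp
  rw [Finsupp.add_apply, Finsupp.single_eq_of_ne hli, Finsupp.single_eq_of_ne hlk, add_zero]

/-- `degree_binExp`: Auxiliary step of this node's calculus, VERBATIM from the lens file (see the module docstring); the statement is its type. [folklore] -/
theorem degree_binExp {i k : Fin 3} (n a : ℕ) (ha : a ≤ n) : (binExp i k n a).degree = n := by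
  unfold binExp
  rw [map_add, Finsupp.degree_single, Finsupp.degree_single]
  omega

/-- `binExp_update`: Auxiliary step of this node's calculus, VERBATIM from the lens file (see the module docstring); the statement is its type. [folklore] -/
theorem binExp_update {i k : Fin 3} (hki : k ≠ i) (n a : ℕ) : (binExp i k n a).update i 0 = Finsupp.single k a := by
  ext l
  unfold binExp
  rw [update_apply', Finsupp.add_apply]
  by_cases hl : l = i
  · rw [if_pos hl, hl, Finsupp.single_eq_of_ne hki.symm]
  · rw [if_neg hl, Finsupp.single_eq_of_ne hl, zero_add]

/-- **THE POWER LAW AT A PROXIMITY REPEAT (coefficient form, PROVED).**  Let `t → t+1 → t+2` be two plateau steps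
from orders `o_t, o_{t+1} > q`, and let move `t+1` be a PROXIMITY REPEAT (`j_{t+1} = i ≠ j = j_t`, the centre ON the
component `u_j = 0` created by move `t`, with `k`-coordinate `β`).  Then the residual form `N_t` (a form of degree
`s` in `u_i, u_k`) has the coefficients of a PURE POWER `c · (u_k − β u_i)^s`:
`U_t(0) · coeff_{u_i^{s−a} u_k^a} N_t = η · C(s,a) (−β)^{s−a}` with `η = coeff_{u_k^s} N_{t+1}`. [new] [folklore] -/
theorem coeff_resForm_of_repeat (hroot : IsRoot q s₀) (W : ForcedWalk q s₀) (t : ℕ) {o o' : ℕ}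
    (ho : ordZero (W.st t).F = o) (ho' : ordZero (W.st (t + 1)).F = o') (hqo : q < o) (hqo' : q < o')
    (hplat : (W.st (t + 1)).shade = (W.st t).shade) (hplat' : (W.st (t + 2)).shade = (W.st (t + 1)).shade)
    {n : ℕ} (hn : (W.st t).shade = (n : ℕ∞)) (hS : W.j (t + 1) ≠ W.j t ∧ W.b (t + 1) (W.j t) = 0)
    {k : Fin 3} (hki : k ≠ W.j (t + 1)) (hkj : k ≠ W.j t) {a : ℕ} (ha : a ≤ n) :
    bUnit W t * coeff (binExp (W.j (t + 1)) k n a) (resForm W t o) =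
      coeff (Finsupp.single k n) (resForm W (t + 1) o') *
        (((n.choose a : ℕ) : K) * (- W.b (t + 1) k) ^ (n - a)) := by
  classical
  set i := W.j (t + 1) with hi
  set j := W.j t with hj
  have hn' : (W.st (t + 1)).shade = (n : ℕ∞) := by rw [hplat, hn]
  -- (iv) restriction identity at `t`
  have h4 := restriction_of_plateau hroot W t ho hqo hplat hn (binExp i k n a)
    (binExp_apply_of_ne (Ne.symm hS.1) (Ne.symm hkj) n a) (degree_binExp n a ha)
  -- (iii) the slice of `g = resLayer i s' o'` is the layer of `F'`
  obtain ⟨n₁, hn₁, hon'⟩ := order_eq_shade_add_degree hroot W (t + 1) ho'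
  have hnn : n₁ = n := by have h := hn₁.symm.trans hn'; exact_mod_cast h
  have h3 := coeff_resLayer i (W.st (t + 1)) (walk_r hroot W (t + 1)) o' (binExp i k n a)
    (by rw [degree_binExp n a ha]; omega)
  rw [binExp_update hki] at h3
  -- (v) `g = translate (−b') N'` and the pure slice of the form `N'`
  have hcone := cone_of_plateau hroot W (t + 1) ho' hqo' hplat' hn'
  have hg : resLayer i (W.st (t + 1)) o' = translate (fun l => - W.b (t + 1) l) (resForm W (t + 1) o') := by
    unfold resForm
    rw [JumpCut.translate_translate]
    have h0 : (fun l => W.b (t + 1) l + - W.b (t + 1) l) = (0 : Fin 3 → K) := by funext l; simp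
    rw [h0, PointBlowup.translate_zero]
  have h2 := coeff_single_translate (i := i) (j := j) (k := k) hS.1 hki hkj (fun l => - W.b (t + 1) l)
    (by show - W.b (t + 1) j = 0; rw [hS.2, neg_zero]) (resForm W (t + 1) o') hcone.1
    (fun D hD => coeff_resForm_eq_zero W (t + 1) o' hD) a
  rw [← hg, h3] at h2
  rw [← h4]
  exact h2

/-- `binExp_apply_k`: Auxiliary step of this node's calculus, VERBATIM from the lens file (see the module docstring); the statement is its type. [folklore] -/
theorem binExp_apply_k {i k : Fin 3} (hki : k ≠ i) (n a : ℕ) : binExp i k n a k = a := by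
  unfold binExp
  rw [Finsupp.add_apply, Finsupp.single_eq_of_ne hki, Finsupp.single_eq_same, zero_add]

omit [DecidableEq K] in
/-- **Binomial expansion of the pure power** `(u_k + γ u_i)^n = Σ_a C(n,a) γ^{n−a} u_i^{n−a} u_k^a`. [folklore] -/
theorem linear_pow_eq_sum {i k : Fin 3} (γ : K) (n : ℕ) :
    (X k + C γ * X i : MvPolynomial (Fin 3) K) ^ n =
      ∑ a ∈ Finset.range (n + 1), monomial (binExp i k n a) (((n.choose a : ℕ) : K) * γ ^ (n - a)) := by
  rw [add_pow]
  refine Finset.sum_congr rfl fun a _ => ?_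
  rw [mul_pow, ← map_pow, X_pow_eq_monomial, X_pow_eq_monomial, C_mul_monomial, monomial_mul, ← map_natCast C,
    mul_comm, C_mul_monomial]
  unfold binExp
  congr 1
  · rw [add_comm]
  · ring

/-- **THE POWER LAW AT A PROXIMITY REPEAT (PROVED)** — polynomial form.  Under the hypotheses of
`coeff_resForm_of_repeat`: the residual form of move `t` is a PURE `s`-TH POWER OF A LINEAR FORM, and the line is
the one through the NEXT centre: `N_t = c · (u_k − β u_i)^s`, `c ≠ 0`, `β = b_{t+1}(k)`.  Contrapositive
(**BINARY ⇒ FREE**): if `N_t` is not an `s`-fold line, move `t+1` leaves the newest component. [new] [folklore] -/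
theorem resForm_eq_pow_of_repeat (hroot : IsRoot q s₀) (W : ForcedWalk q s₀) (t : ℕ) {o o' : ℕ}
    (ho : ordZero (W.st t).F = o) (ho' : ordZero (W.st (t + 1)).F = o') (hqo : q < o) (hqo' : q < o')
    (hplat : (W.st (t + 1)).shade = (W.st t).shade) (hplat' : (W.st (t + 2)).shade = (W.st (t + 1)).shade)
    {n : ℕ} (hn : (W.st t).shade = (n : ℕ∞)) (hS : W.j (t + 1) ≠ W.j t ∧ W.b (t + 1) (W.j t) = 0)
    {k : Fin 3} (hki : k ≠ W.j (t + 1)) (hkj : k ≠ W.j t) :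
    ∃ c : K, c ≠ 0 ∧ resForm W t o = C c * (X k - C (W.b (t + 1) k) * X (W.j (t + 1))) ^ n := by
  classical
  set i := W.j (t + 1) with hi
  set j := W.j t with hj
  set β := W.b (t + 1) k with hβ
  set c : K := coeff (Finsupp.single k n) (resForm W (t + 1) o') / bUnit W t with hc
  have hcone := cone_of_plateau hroot W t ho hqo hplat hn
  have hcoef : ∀ a, a ≤ n → coeff (binExp i k n a) (resForm W t o) = c * (((n.choose a : ℕ) : K) * (-β) ^ (n - a)) := by
    intro a ha
    have h := coeff_resForm_of_repeat hroot W t ho ho' hqo hqo' hplat hplat' hn hS hki hkj ha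
    rw [hc, div_mul_eq_mul_div, eq_div_iff (bUnit_ne_zero W t), mul_comm]
    exact h
  have hid : resForm W t o = C c * (X k - C β * X i) ^ n := by
    rw [show (X k - C β * X i : MvPolynomial (Fin 3) K) = X k + C (-β) * X i by
      rw [map_neg, neg_mul, sub_eq_add_neg], linear_pow_eq_sum (-β) n, Finset.mul_sum]
    ext D
    rw [coeff_sum]
    simp only [coeff_C_mul, coeff_monomial]
    by_cases hDj : D j = 0
    · by_cases hdeg : D.degree = n
      · -- `D = binExp i k n (D k)`
        have hDk : D k ≤ n := by
          have := degree_eq_add_sum_erase k D; omega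
        have hD : D = binExp i k n (D k) := by
          have hsum := degree_eq_add_sum_erase i D
          have hsum2 : ∑ l ∈ univ.erase i, D l = D k + ∑ l ∈ (univ.erase i).erase k, D l :=
            (Finset.add_sum_erase _ _ (Finset.mem_erase.mpr ⟨hki, Finset.mem_univ k⟩)).symm
          have hsum3 : ∑ l ∈ (univ.erase i).erase k, D l = 0 := by
            refine Finset.sum_eq_zero fun l hl => ?_
            have hlk : l ≠ k := Finset.ne_of_mem_erase hl
            have hli : l ≠ i := Finset.ne_of_mem_erase (Finset.mem_of_mem_erase hl)
            rcases fin3_cases hS.1 hki hkj l with h | h | h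
            · exact absurd h hli
            · rw [h, hDj]
            · exact absurd h hlk
          ext l
          rcases fin3_cases hS.1 hki hkj l with h | h | h
          · rw [h]
            unfold binExp
            rw [Finsupp.add_apply, Finsupp.single_eq_same, Finsupp.single_eq_of_ne hki.symm, add_zero]
            omega
          · rw [h, hDj, binExp_apply_of_ne (Ne.symm hS.1) hkj.symm]
          · rw [h, binExp_apply_k hki]
        conv_lhs => rw [hD]
        rw [hcoef (D k) hDk, Finset.sum_eq_single (D k)]
        · rw [if_pos hD.symm]
        · intro a _ hne
          rw [if_neg]
          · exact mul_zero c
          · intro h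
            apply hne
            have := DFunLike.congr_fun h k
            rw [binExp_apply_k hki] at this
            exact this
        · intro h
          exact absurd (Finset.mem_range.mpr (by omega)) h
      · rw [hcone.1.coeff_eq_zero hdeg, Finset.sum_eq_zero]
        intro a ha
        rw [if_neg]
        · exact mul_zero c
        · intro h
          apply hdeg
          rw [← h, degree_binExp n a (by have := Finset.mem_range.mp ha; omega)]
    · rw [coeff_resForm_eq_zero W t o hDj, Finset.sum_eq_zero]
      intro a _
      rw [if_neg]
      · exact mul_zero c
      · intro h
        apply hDj
        rw [← h, binExp_apply_of_ne (Ne.symm hS.1) hkj.symm]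
  refine ⟨c, ?_, hid⟩
  intro h0
  apply hcone.2
  rw [hid, h0, map_zero, zero_mul]

/-! ## §C  LAW B — free high plateaux are rigid high floors (boundary ledger only) -/

end Walks

end Summit.ResolutionOfSingularities.ResolutionOfSingularities.Theorems.ConeCut
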